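import Mathlib
import HarnessLib
import Literature.Computability.Cryptography.OneWayFunctions
import Literature.Computability.Cryptography.StatisticalDistance
import Literature.Computability.Cryptography.QuantumQuery
import Literature.Computability.QuantumComplexity.PromiseWrap
import Literature.Computability.QuantumComplexity.BPPRelSubsetBQPRel
import Literature.Computability.Cryptography.ClassBQPComplementProofs
import Literature.Computability.Complexity.PromiseBPPAmplification
import Literature.Computability.Complexity.PromiseBPPClosureProofs
import Literature.Computability.Complexity.AdaptiveBPPSimulation
import Literature.Computability.Complexity.PlumbingBricks
import Literature.Computability.Complexity.HashBricks
import Literature.Computability.Complexity.CountingHierarchyProofs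
import Literature.Computability.Complexity.CoinCounting

/-!
# QuantumAdvantage / WhiteBoxWalk — planted search refutes the promise collapse (route-independent form)

`(∃ gen ans, …planted unique-answer white-box quantum advantage…) → ¬ (PromiseBQP ⊆ PromiseBPP')`.

This is the CONTENT of the route item `Theses.WhiteBoxWalk.WbwSearchToPromise`
(stmt-QuantumAdvantage-2240), already settled by
`Summit.QuantumAdvantage.QuantumAdvantage.Theorems.WhiteBoxWalk.wbwSearchToPromise_proof`
(`Theorems/WhiteBoxWalkWbwSearchToPromise.lean`), restated here over `Literature` ONLY — this
module does not import `Theses.WhiteBoxWalk` — so that the route file can import it and DISCHARGE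
the proved support inside its deciding theorem `closes` instead of carrying it as a hypothesis
(docs/architecture/obligation-graph.md: "supports … are PROVED LEMMAS used INSIDE the proof of
`closes`, not hypotheses of it"; tribunal repair 2026-08-17, route-QuantumAdvantage-WhiteBoxWalk:
a proved binder is read by the kernel tribunal as a strong-hypothesis-dominated crux, rule (a)).
The proof is the accepted one, verbatim up to namespacing (helpers are `private` here).

Statement and proof (the promise form of "pseudo-deterministic search reduces to a `BQP`
decision problem", Aaronson–Gur–Li, arXiv:2602.17647, Thm. 1.7; Goldreich 2006, §1.1):
let `X` give a poly-time instance generator `gen`, an answer map `ans` with `|ans s| = p(|gen s|)`,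
(Q) ONE uniform oracle-free Clifford+T family writing `ans s` on its first wires with probability
`≥ 2/3` on input `gen s` for EVERY seed `s`, and (C) every PPT algorithm given `(1ⁿ, gen s)`
outputs `ans s` with negligible probability on average over `s ∈ {0,1}ⁿ`.

1. `ans_eq_of_gen_eq`: (Q) forces `ans s = ans s'` whenever `gen s = gen s'` (two distinct
   equal-length prefixes are disjoint events of probability `≥ 2/3` each); so `ans = ans' ∘ gen`.
2. `bitProblem_mem_PromiseBQP`: the bit promise problem `Π` — instances `⟨x, v⟩` with `x = gen s`,
   YES iff bit `|v|` of `ans' x` is `1`, NO iff it is `0` — is in `PromiseBQP`, by the tree's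
   classical wrap of quantum search (`mem_PromiseBQP_of_isQSolvable`: pre-processor `fstF`,
   post-processor `⟨⟨x, v⟩, y⟩ ↦ [y_{|v|}]` assembled from `FP` bricks).
3. Under `PromiseBQP ⊆ PromiseBPP'`: pull `Π` back along `fstF` (Karp closure of `PromiseBPP'`),
   amplify to error `1/(3p+1)` (`exists_amplifier_of_mem_PromiseBPP'`), and let the PPT `A` answer
   the `p(|x|)` pseudo-deterministic queries `⟨x, (ans' x) ↾ k⟩` with ONE coin string (the tree's
   `AdBPPSim.accF` with query map `id`); by the union bound (`uniformProb_accF_ne_le_third`) it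
   outputs `ans s` with probability `≥ 2/3` for every `s`, so every uniform average is `≥ 2/3`,
   contradicting superpolynomial decay (exponent `0`).

No new definitions; all plumbing is the tree's (`PromiseWrap`, `AdaptiveBPPSimulation`,
`PromiseBPPAmplification`, `PromiseBPPClosureProofs`, brick algebra).
-/

set_option linter.dupNamespace false -- D-0017: single-problem summit ⇒ `QuantumAdvantage.QuantumAdvantage` by design

namespace Summit.QuantumAdvantage.QuantumAdvantage.Theorems.WhiteBoxWalk.SearchToPromiseFree

open _root_.Computability Literature.Computability.Complexity Literature.Computability.Cryptography
  Literature.Computability.QuantumComplexity Brick HashBricks Plumb AdBPPSim AdQuery Filter Polynomial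


/-- **(Q) makes the answer a function of the instance.** If one family outputs `ans s` (a prefix of
length `p(|gen s|)` of the measured string) with probability `≥ 2/3` on input `gen s` for every
`s`, then `gen s = gen s'` forces `ans s = ans s'`: otherwise the two prefix events are disjoint
and would have total probability `≥ 4/3`. [folklore] -/
private theorem ans_eq_of_gen_eq {gen ans : List Bool → List Bool} {p : Polynomial ℕ}
    (hp : ∀ s, (ans s).length = p.eval (gen s).length) {F : QCircuitFamily cliffordT}
    (hQ : ∀ s, 2 / 3 ≤ F.kernelProb 0 (gen s) {y | ans s <+: y}) {s s' : List Bool}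
    (h : gen s = gen s') : ans s = ans s' := by
  by_contra hne
  have hlen : (ans s).length = (ans s').length := by rw [hp, hp, h]
  have hdisj : Disjoint {y : List Bool | ans s <+: y} {y | ans s' <+: y} := by
    refine Set.disjoint_left.2 fun y h1 h2 => hne ?_
    exact (List.prefix_of_prefix_length_le h1 h2 hlen.le).eq_of_length hlen
  have h1 := hQ s
  have h2 := hQ s'
  rw [← h] at h2
  have := kernelProb_add_kernelProb_le_one F 0 (gen s) hdisj
  linarith

/-! ### Step 2: the bit promise problem is in `PromiseBQP` -/

/-- The post-processor `⟨⟨x, v⟩, y⟩ ↦ [y_{|v|}]` (bit `|v|` of `y`, default `0`), assembled from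
the tree's `FP` bricks. [folklore] -/
private theorem bitPost_apply (x v y : List Bool) :
    (headBitFn ∘ dropFn ∘ fanoutFn (sndF ∘ fstF) sndF) (boolPair (boolPair x v) y) =
      [y[v.length]?.getD false] := by
  simp [List.headD_eq_head?_getD, List.head?_drop]

/-- The post-processor is polynomial-time. [folklore] -/
private theorem bitPost_mem_FP : headBitFn ∘ dropFn ∘ fanoutFn (sndF ∘ fstF) sndF ∈ FP :=
  comp_mem_FP headBitFn_mem_FP (comp_mem_FP dropFn_mem_FP
    (fanoutFn_mem_FP (comp_mem_FP sndF_mem_FP fstF_mem_FP) sndF_mem_FP))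

/-- **The bit promise problem of a pseudo-deterministic quantum search problem is in
`PromiseBQP`.** If a uniform oracle-free Clifford+T family writes `ans' (gen s)` first with
probability `≥ 2/3` on every instance `gen s`, then the promise problem whose yes- (no-)
instances are the pairs `⟨gen s, v⟩` with bit `|v|` of `ans' (gen s)` equal to `1` (`0`) is in
`PromiseBQP`: wrap the search family with the pre-processor `fstF` and the post-processor
`⟨⟨x, v⟩, y⟩ ↦ [y_{|v|}]`. [cite: Watrous2009, §III.2] -/
private theorem bitProblem_mem_PromiseBQP {gen : List Bool → List Bool} (ans' : List Bool → List Bool)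
    {F : QCircuitFamily cliffordT} (hF : F.IsOracleFree) (hU : F.IsUniform)
    (hQ : ∀ s, 2 / 3 ≤ F.kernelProb 0 (gen s) {y | ans' (gen s) <+: y}) (Q : PromiseProblem)
    (hyes : ∀ z ∈ Q.yes, ∃ s v, z = boolPair (gen s) v ∧ (ans' (gen s))[v.length]? = some true)
    (hno : ∀ z ∈ Q.no, ∃ s v, z = boolPair (gen s) v ∧ (ans' (gen s))[v.length]? = some false) :
    Q ∈ PromiseBQP := by
  classical
  -- the search relation: the canonical answer on instances, anything elsewhere
  obtain ⟨R, hRgen, hRoff⟩ : ∃ R : List Bool → Set (List Bool),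
      (∀ s, R (gen s) = {y | ans' (gen s) <+: y}) ∧ ∀ x, (¬ ∃ s, gen s = x) → R x = Set.univ := by
    refine ⟨fun x => if ∃ s, gen s = x then {y | ans' x <+: y} else Set.univ, fun s => ?_, fun x hx => ?_⟩
    · exact if_pos ⟨s, rfl⟩
    · exact if_neg hx
  have hR : IsQSolvable R := by
    refine ⟨F, hF, hU, fun x => ?_⟩
    by_cases hx : ∃ s, gen s = x
    · obtain ⟨s, rfl⟩ := hx
      rw [hRgen]
      exact hQ s
    · rw [hRoff x hx, QCircuitFamily.kernelProb_univ_eq_one]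
      norm_num
  refine mem_PromiseBQP_of_isQSolvable Q fstF _ fstF_mem_FP bitPost_mem_FP hR ?_ ?_
  · intro z hz y hy
    obtain ⟨s, v, rfl, hbit⟩ := hyes z hz
    rw [fstF_boolPair, hRgen] at hy
    obtain ⟨w, rfl⟩ := hy
    obtain ⟨hk, -⟩ := List.getElem?_eq_some_iff.1 hbit
    rw [bitPost_apply, List.getElem?_append_left hk, hbit]
    rfl
  · intro z hz y hy
    obtain ⟨s, v, rfl, hbit⟩ := hno z hz
    rw [fstF_boolPair, hRgen] at hy
    obtain ⟨w, rfl⟩ := hy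
    obtain ⟨hk, -⟩ := List.getElem?_eq_some_iff.1 hbit
    rw [bitPost_apply, List.getElem?_append_left hk, hbit]
    rfl

/-! ### Step 3: one coin string answers all the pseudo-deterministic queries -/

/-- **Pseudo-determinism of the query path.** If the simulated oracle `X` agrees with the
yes-set on the `|a|` queries `⟨x, a ↾ k⟩`, and `⟨x, a ↾ k⟩` is a yes-instance iff bit `k` of `a`
is `1`, then the adaptive answer string with query map `id` reproduces `a`. [folklore] -/
private theorem adBits_eq_take {X : Language Bool} {Y : Set (List Bool)} (a x : List Bool)
    (hY : ∀ k < a.length, (boolPair x (a.take k) ∈ Y ↔ a[k]? = some true))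
    (hagree : ∀ k < a.length, (boolPair x (a.take k) ∈ X ↔ boolPair x (a.take k) ∈ Y)) :
    ∀ k ≤ a.length, adBits id X x k = a.take k
  | 0, _ => by simp
  | k + 1, hk => by
    have hk' : k < a.length := hk
    rw [adBits_succ, adBits_eq_take a x hY hagree k hk'.le, List.take_succ_eq_append_getElem hk']
    simp only [id]
    congr 2
    by_cases hb : a[k] = true
    · have hmem : boolPair x (a.take k) ∈ X :=
        (hagree k hk').2 ((hY k hk').2 (by rw [List.getElem?_eq_getElem hk', hb]))
      rw [(Set.mem_iff_boolIndicator _ _).1 hmem, hb]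
    · have hb' : a[k] = false := by simpa using hb
      have hmem : boolPair x (a.take k) ∉ X := fun hx => by
        have h1 := (hY k hk').1 ((hagree k hk').1 hx)
        rw [List.getElem?_eq_getElem hk', hb'] at h1
        simp at h1
      rw [(Set.notMem_iff_boolIndicator _ _).1 hmem, hb']

/-- **The union bound over the query path.** With coins of length `T` (long enough for every
query), the simulated answer string `accF B t id p ⟨x, r⟩` differs from `a` (`|a| = p(|x|)`) only
if the coin string errs on one of the `|a|` queries `⟨x, a ↾ k⟩`; if each such error has
probability `≤ 1/(3|a| + 1)`, the total is `≤ 1/3`. [cite: AroraBarak2009, §7.4.1] -/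
private theorem uniformProb_accF_ne_le_third {B : Language Bool} {t p : Polynomial ℕ} {Y : Set (List Bool)}
    (a x : List Bool) {T : ℕ} (hlen : p.eval x.length = a.length)
    (hY : ∀ k < a.length, (boolPair x (a.take k) ∈ Y ↔ a[k]? = some true))
    (herr : ∀ k < a.length, uniformProb (t.eval (padQ (boolPair x (a.take k))).length)
      {y | ¬ (boolPair (padQ (boolPair x (a.take k))) y ∈ B ↔ boolPair x (a.take k) ∈ Y)} ≤
        1 / (3 * a.length + 1))
    (hT : ∀ k < a.length, t.eval (padQ (boolPair x (a.take k))).length ≤ T) :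
    uniformProb T {r | accF B t id p (boolPair x r) ≠ a} ≤ 1 / 3 := by
  set Bad : ℕ → Set (List Bool) := fun k =>
    {r | ¬ (boolPair x (a.take k) ∈ coinLang B t r ↔ boolPair x (a.take k) ∈ Y)} with hBad
  have hBadP : ∀ k < a.length, uniformProb T (Bad k) ≤ 1 / (3 * a.length + 1) := by
    intro k hk
    have hset : Bad k = {r | r.take (t.eval (padQ (boolPair x (a.take k))).length) ∈
        {y | ¬ (boolPair (padQ (boolPair x (a.take k))) y ∈ B ↔ boolPair x (a.take k) ∈ Y)}} := rfl
    rw [hset, uniformProb_take_of_le (hT k hk)]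
    exact herr k hk
  have hsub : ∀ r ∈ {r : List Bool | accF B t id p (boolPair x r) ≠ a}, r.length = T →
      r ∈ ⋃ k ∈ Finset.range a.length, Bad k := by
    intro r hr _
    by_contra hgood
    simp only [Set.mem_iUnion, Finset.mem_range, not_exists] at hgood
    apply hr
    rw [accF_apply, hlen]
    have key := adBits_eq_take (X := coinLang B t r) a x hY (fun k hk => ?_) a.length le_rfl
    · rw [key, List.take_length]
    · have h := hgood k hk
      simp only [hBad, Set.mem_setOf_eq, not_not] at h
      exact h
  calc uniformProb T {r | accF B t id p (boolPair x r) ≠ a}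
      ≤ uniformProb T (⋃ k ∈ Finset.range a.length, Bad k) := BPExp.uniformProb_mono_len hsub
    _ ≤ ∑ k ∈ Finset.range a.length, uniformProb T (Bad k) := uniformProb_biUnion_le _ _ _
    _ ≤ ∑ _k ∈ Finset.range a.length, (1 : ℝ) / (3 * a.length + 1) :=
        Finset.sum_le_sum fun k hk => hBadP k (Finset.mem_range.1 hk)
    _ = a.length * (1 / (3 * a.length + 1)) := by
        rw [Finset.sum_const, Finset.card_range, nsmul_eq_mul]
    _ ≤ 1 / 3 := by
        rw [mul_one_div, div_le_iff₀ (by positivity)]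
        linarith

/-- From a small failure probability to a large success probability of a `RandAlg` event
containing the target string. [folklore] -/
private theorem pr_ge_of_uniformProb_ne_le {A : RandAlg (List Bool) (List Bool)} {u a : List Bool}
    {E : Set (List Bool)} (ha : a ∈ E)
    (h : uniformProb (A.coinLen u.length) {r | A.run u r ≠ a} ≤ 1 / 3) : 2 / 3 ≤ A.pr id u E := by
  rw [RandAlg.pr_eq_uniformProb]
  have h1 : uniformProb (A.coinLen u.length) {r | A.run u r = a} ≤
      uniformProb (A.coinLen (id u).length) {r | A.run u r ∈ E} :=
    BPExp.uniformProb_mono_len fun r hr _ => by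
      simp only [Set.mem_setOf_eq] at hr ⊢
      rw [hr]
      exact ha
  have h2 : uniformProb (A.coinLen u.length) {r | A.run u r = a} =
      1 - uniformProb (A.coinLen u.length) {r | A.run u r ≠ a} := by
    rw [← Literature.Computability.Complexity.uniformProb_compl]
    congr 1
    ext r
    simp
  linarith

/-- A pointwise lower bound passes to the uniform average. [folklore] -/
private theorem le_uniformAvg {n : ℕ} {g : List Bool → ℝ} {c : ℝ} (hg : ∀ x, c ≤ g x) :
    c ≤ uniformAvg n g := by
  unfold uniformAvg
  rw [le_div_iff₀ (by positivity)]
  calc c * 2 ^ n = ∑ _x : List.Vector Bool n, c := by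
        rw [Finset.sum_const, Finset.card_univ, card_vector, Fintype.card_bool, nsmul_eq_mul]
        push_cast
        ring
    _ ≤ ∑ x : List.Vector Bool n, g x.toList := Finset.sum_le_sum fun x _ => hg _

/-! ### The statement, over `Literature` only -/

/-- **Planted unique-answer quantum advantage refutes `PromiseBQP ⊆ PromiseBPP'`** (the content of
route item `Theses.WhiteBoxWalk.WbwSearchToPromise`, stmt-QuantumAdvantage-2240, stated without the
route file): the bitwise promise problems of the pseudo-deterministic search problem
`gen s ↦ ans s` are in `PromiseBQP` (step 2); under the inclusion, amplified `PromiseBPP'` deciders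
answer all `p(|x|)` bit queries along the (deterministic) answer path correctly with probability
`≥ 2/3` using one coin string, so a PPT algorithm outputs `ans s` on `(1ⁿ, gen s)` with probability
`≥ 2/3` for EVERY `s`, and the uniform averages in (C) are all `≥ 2/3` — not superpolynomially
decaying. Promise form of Aaronson–Gur–Li, arXiv:2602.17647, Thm. 1.7 (pseudo-deterministic search
⇔ search-to-decision to `BQP`). [cite: Goldreich2006, §1.1] -/
theorem plantedSearch_not_promiseCollapse :
    (∃ (gen ans : List Bool → List Bool), PolyTimeComputable id id gen ∧
      (∃ p : Polynomial ℕ, ∀ s, (ans s).length = p.eval (gen s).length) ∧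
      (∃ F : QCircuitFamily cliffordT, F.IsOracleFree ∧ F.IsUniform ∧
        ∀ s, 2 / 3 ≤ F.kernelProb 0 (gen s) {y | ans s <+: y}) ∧
      ∀ A : RandAlg (List Bool) (List Bool), IsPPT A id →
        Asymptotics.SuperpolynomialDecay atTop (fun n : ℕ => (n : ℝ))
          (fun n : ℕ => uniformAvg n fun s =>
            A.pr id (boolPair (unaryEncodeNat n) (gen s)) {y | ans s <+: y})) →
    ¬ (PromiseBQP ⊆ PromiseBPP') := by
  classical
  rintro ⟨gen, ans, -, ⟨p, hp⟩, ⟨F, hF, hU, hFQ⟩, hC⟩ hsub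
  -- Step 1: canonical answers `ans'` on instances, `ans = ans' ∘ gen`
  obtain ⟨ans', hans'⟩ : ∃ ans' : List Bool → List Bool, ∀ s, ans' (gen s) = ans s := by
    refine ⟨fun x => if h : ∃ s, gen s = x then ans h.choose else [], fun s => ?_⟩
    have h : ∃ s', gen s' = gen s := ⟨s, rfl⟩
    simp only [dif_pos h]
    exact ans_eq_of_gen_eq hp hFQ h.choose_spec
  -- Step 2: the bit promise problem
  obtain ⟨Q, hQyes, hQno⟩ : ∃ Q : PromiseProblem,
      (∀ z, z ∈ Q.yes ↔ ∃ s v, z = boolPair (gen s) v ∧ (ans' (gen s))[v.length]? = some true) ∧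
      (∀ z, z ∈ Q.no ↔ ∃ s v, z = boolPair (gen s) v ∧ (ans' (gen s))[v.length]? = some false) :=
    ⟨⟨{z | ∃ s v, z = boolPair (gen s) v ∧ (ans' (gen s))[v.length]? = some true},
      {z | ∃ s v, z = boolPair (gen s) v ∧ (ans' (gen s))[v.length]? = some false}⟩,
      fun _ => Iff.rfl, fun _ => Iff.rfl⟩
  have hQ : Q ∈ PromiseBQP :=
    bitProblem_mem_PromiseBQP ans' hF hU (fun s => by rw [hans']; exact hFQ s) Q
      (fun z hz => (hQyes z).1 hz) (fun z hz => (hQno z).1 hz)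
  -- membership of the path queries
  have hY : ∀ s, ∀ k < (ans s).length,
      (boolPair (gen s) ((ans s).take k) ∈ Q.yes ↔ (ans s)[k]? = some true) := by
    intro s k hk
    rw [hQyes]
    constructor
    · rintro ⟨s', v, heq, hbit⟩
      obtain ⟨h1, h2⟩ := QCircuit.boolPair_inj heq
      rw [← h1, hans', ← h2, List.length_take, min_eq_left hk.le] at hbit
      exact hbit
    · intro hbit
      exact ⟨s, _, rfl, by rw [hans', List.length_take, min_eq_left hk.le, hbit]⟩
  have hN : ∀ s, ∀ k < (ans s).length, (ans s)[k]? = some false →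
      boolPair (gen s) ((ans s).take k) ∈ Q.no ∧ boolPair (gen s) ((ans s).take k) ∉ Q.yes := by
    intro s k hk hbit
    refine ⟨(hQno _).2 ⟨s, _, rfl, by rw [hans', List.length_take, min_eq_left hk.le, hbit]⟩,
      fun h => ?_⟩
    rw [(hY s k hk).1 h] at hbit
    cases hbit
  -- Step 3: amplified deciders for the pulled-back problem
  have hQ' : (⟨{w | fstF w ∈ Q.yes}, {w | fstF w ∈ Q.no}⟩ : PromiseProblem) ∈ PromiseBPP' :=
    PromiseProblem.mem_PromiseBPP'_of_polyTimeReducible_holds'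
      ⟨fstF, fstF_mem_FP, fun w hw => hw, fun w hw => hw⟩ (hsub hQ)
  obtain ⟨B, hB, t, hyesB, hnoB, -⟩ :=
    PromiseProblem.exists_amplifier_of_mem_PromiseBPP' hQ' (3 * p)
  -- per-query error of the path queries
  have herr : ∀ s, ∀ k < (ans s).length,
      uniformProb (t.eval (padQ (boolPair (gen s) ((ans s).take k))).length)
        {y | ¬ (boolPair (padQ (boolPair (gen s) ((ans s).take k))) y ∈ B ↔
          boolPair (gen s) ((ans s).take k) ∈ Q.yes)} ≤ 1 / (3 * (ans s).length + 1) := by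
    intro s k hk
    set q := boolPair (gen s) ((ans s).take k) with hq
    have hbound : (1 : ℝ) / ((3 * p).eval (padQ q).length + 1) ≤ 1 / (3 * (ans s).length + 1) := by
      have hmono : p.eval (gen s).length ≤ p.eval (padQ q).length :=
        TM2Iter.eval_mono p (by rw [length_padQ, hq, length_boolPair]; omega)
      have h3 : (3 * ((ans s).length : ℝ) + 1) ≤ (3 * p).eval (padQ q).length + 1 := by
        rw [hp s]
        have : (((3 * p).eval (padQ q).length : ℕ) : ℝ) = 3 * ((p.eval (padQ q).length : ℕ) : ℝ) := by
          have h3p : (3 * p).eval (padQ q).length = 3 * p.eval (padQ q).length := by simp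
          rw [h3p]; push_cast; ring
        rw [this]
        have := (Nat.cast_le (α := ℝ)).2 hmono
        linarith
      exact one_div_le_one_div_of_le (by positivity) h3
    obtain ⟨b, hb⟩ : ∃ b, (ans s)[k]? = some b := ⟨(ans s)[k], List.getElem?_eq_getElem hk⟩
    cases b with
    | true =>
      have hqy : q ∈ Q.yes := (hY s k hk).2 hb
      have hset : {y | ¬ (boolPair (padQ q) y ∈ B ↔ q ∈ Q.yes)} = {y | boolPair (padQ q) y ∉ B} := by
        ext y
        simp [hqy]
      rw [hset]
      exact (hyesB (padQ q) (show fstF (padQ q) ∈ Q.yes by simpa using hqy)).trans hbound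
    | false =>
      obtain ⟨hqn, hqy⟩ : q ∈ Q.no ∧ q ∉ Q.yes := hN s k hk hb
      have hset : {y | ¬ (boolPair (padQ q) y ∈ B ↔ q ∈ Q.yes)} = {y | boolPair (padQ q) y ∈ B} := by
        ext y
        simp [hqy]
      rw [hset]
      exact (hnoB (padQ q) (show fstF (padQ q) ∈ Q.no by simpa using hqn)).trans hbound
  -- the PPT algorithm answering all queries with one coin string
  set T : Polynomial ℕ := t.comp (2 * (2 * X + 2 + p) + 3) with hTdef
  have hFP : accF B t id p ∘ fanoutFn (sndF ∘ fstF) sndF ∈ FP :=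
    comp_mem_FP (accF_mem_FP OracleCompose.id_mem_FP hB)
      (fanoutFn_mem_FP (comp_mem_FP sndF_mem_FP fstF_mem_FP) sndF_mem_FP)
  obtain ⟨A, hA, hArun, hAcoin⟩ : ∃ A : RandAlg (List Bool) (List Bool), IsPPT A id ∧
      (∀ u r, A.run u r = accF B t id p (boolPair (sndF u) r)) ∧ ∀ n, A.coinLen n = T.eval n :=
    ⟨⟨fun u r => accF B t id p (boolPair (sndF u) r), fun n => T.eval n⟩,
      isPolyTime_of_FP (eb := id) hFP T (fun u r => by simp), fun _ _ => rfl, fun _ => rfl⟩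
  -- success on every seed
  have hs : ∀ n s, (2 : ℝ) / 3 ≤ A.pr id (boolPair (unaryEncodeNat n) (gen s)) {y | ans s <+: y} := by
    intro n s
    refine pr_ge_of_uniformProb_ne_le (a := ans s) List.prefix_rfl ?_
    have hrun : {r | A.run (boolPair (unaryEncodeNat n) (gen s)) r ≠ ans s} =
        {r | accF B t id p (boolPair (gen s) r) ≠ ans s} := by
      ext r
      rw [Set.mem_setOf_eq, Set.mem_setOf_eq, hArun, sndF_boolPair]
    rw [hrun, hAcoin]
    refine uniformProb_accF_ne_le_third (Y := Q.yes) (ans s) (gen s) (hp s).symm (hY s) (herr s)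
      fun k hk => ?_
    rw [hTdef, eval_comp]
    refine TM2Iter.eval_mono t ?_
    have h1 : (padQ (boolPair (gen s) ((ans s).take k))).length ≤ 2 * (2 * (gen s).length + 2 + (ans s).length) + 3 := by
      rw [length_padQ, length_boolPair, List.length_take]
      omega
    have h2 : (gen s).length ≤ (boolPair (unaryEncodeNat n) (gen s)).length := by
      rw [length_boolPair]; omega
    have h3 : (ans s).length ≤ p.eval (boolPair (unaryEncodeNat n) (gen s)).length := by
      rw [hp s]; exact TM2Iter.eval_mono p h2
    have h4 : (2 * (2 * X + 2 + p) + 3 : Polynomial ℕ).eval (boolPair (unaryEncodeNat n) (gen s)).length =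
        2 * (2 * (boolPair (unaryEncodeNat n) (gen s)).length + 2 + p.eval (boolPair (unaryEncodeNat n) (gen s)).length) + 3 := by
      simp
    rw [h4]
    omega
  have havg : ∀ n, (2 : ℝ) / 3 ≤
      uniformAvg n (fun s => A.pr id (boolPair (unaryEncodeNat n) (gen s)) {y | ans s <+: y}) :=
    fun n => le_uniformAvg fun s => hs n s
  -- contradiction with superpolynomial decay at exponent `0`
  have h0 := hC A hA 0
  simp only [pow_zero, one_mul] at h0
  obtain ⟨n, hn⟩ := (h0.eventually (Iio_mem_nhds (show (0 : ℝ) < 2 / 3 by norm_num))).exists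
  exact absurd (havg n) (not_le.2 hn)

end Summit.QuantumAdvantage.QuantumAdvantage.Theorems.WhiteBoxWalk.SearchToPromiseFree
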